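import Literature.Probability.LatticeModels.MeshDomainBulk
import Mathlib.Analysis.InnerProductSpace.Basic
import Mathlib.Analysis.Complex.Basic
import HarnessLib

/-!
# Screening recursion for `SAWCircleScreening`, part III: lattice geometry of a flat half-disc

Route `SAWCircleScreening` of `CriticalPhenomena/SAWScalingLimit`, support item
`ScreeningRecursion` (stmt-CriticalPhenomena-5468). Near a marked point `c` the tame domain is
EXACTLY a half-disc: `Ω ∩ B(c, ρ₀) = {z | 0 < Im((z - c) u)} ∩ B(c, ρ₀)`. The multi-scale
coupling removes near data `K ⊆ B̄(c, r_K)` from `Ω`; to keep control of the largest mesh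
component we need explicit lattice paths that leave the vicinity of `c` monotonically and climb
into the core of the domain while avoiding `B̄(c, r_K)`. This part is the plane geometry:

* the height `Im((z - c) u)` above the flat boundary line: additivity, Lipschitz bound, and the
  consequences of flatness (`mem_iff_of_flat`, `center_not_mem_of_flat`, the route form);
* lattice steps `Site.toComplex (Pi.single i s)` (`= ±1, ±i`), `meshPoint_add`;
* `exists_good_step` — from a point of positive height some lattice direction `e` increases the
  height strictly and the distance to `c` weakly;
* `exists_best_step` — the lattice direction of steepest ascent `e₊`
  (`Im(e₊ u) = max(|Re u|, |Im u|) ≥ ‖u‖/√2`, `|Re(e₊ u)| ≤ Im(e₊ u)`), and the **escape estimate**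
  `sq_norm_add_ge_half`: along `p + t e₊`, `t ≥ 0`, the squared distance to `c` never drops
  below half its initial value (from `0 < Im((p - c) u)`);
* `exists_of_mem_segment_ray` — points of a segment of a ray are real points of the ray.

All elementary (folklore); Mathlib anchors: `norm_add_sq_real`, `Complex.inner`, `segment`.
-/

noncomputable section

open Set Metric Complex
open scoped ComplexConjugate
open Literature.Probability.LatticeModels

namespace Summit.CriticalPhenomena.SAWScalingLimit.Theorems.ScreeningRecursion

/-! ## Height above the flat boundary line -/

/-- The height `Im((z - c) u)` is affine: at `z + w` it is the height at `z` plus `Im(w u)`.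
[folklore] -/
theorem hgt_add (c u z w : ℂ) : ((z + w - c) * u).im = ((z - c) * u).im + (w * u).im := by
  rw [show (z + w - c) * u = (z - c) * u + w * u by ring, Complex.add_im]

/-- The height along a real multiple of a step: `Im((p + t e - c) u) = Im((p - c) u) + t Im(e u)`.
[folklore] -/
theorem hgt_add_real_mul (c u p e : ℂ) (t : ℝ) :
    ((p + (t : ℂ) * e - c) * u).im = ((p - c) * u).im + t * (e * u).im := by
  rw [hgt_add, mul_assoc, Complex.im_ofReal_mul]

/-- The height is `‖u‖`-Lipschitz. [folklore] -/
theorem abs_hgt_sub_hgt_le (c u z y : ℂ) :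
    |((z - c) * u).im - ((y - c) * u).im| ≤ ‖z - y‖ * ‖u‖ := by
  rw [← Complex.sub_im, show (z - c) * u - (y - c) * u = (z - y) * u by ring]
  exact (Complex.abs_im_le_norm _).trans (norm_mul_le _ _)

/-! ## Flatness: `Ω ∩ B(c, ρ₀) = {0 < height} ∩ B(c, ρ₀)` -/

section Flat

variable {Ω : Set ℂ} {c u : ℂ} {ρ₀ : ℝ}

/-- Inside the flat ball, membership in `Ω` is positivity of the height. [folklore] -/
theorem mem_iff_of_flat (h : Ω ∩ ball c ρ₀ = {z | 0 < ((z - c) * u).im} ∩ ball c ρ₀) {z : ℂ}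
    (hz : z ∈ ball c ρ₀) : z ∈ Ω ↔ 0 < ((z - c) * u).im := by
  constructor
  · intro hzΩ
    have : z ∈ Ω ∩ ball c ρ₀ := ⟨hzΩ, hz⟩
    rw [h] at this
    exact this.1
  · intro hh
    have : z ∈ {z | 0 < ((z - c) * u).im} ∩ ball c ρ₀ := ⟨hh, hz⟩
    rw [← h] at this
    exact this.1

/-- Flatness at a smaller radius. [folklore] -/
theorem flat_mono (h : Ω ∩ ball c ρ₀ = {z | 0 < ((z - c) * u).im} ∩ ball c ρ₀) {r : ℝ}
    (hr : r ≤ ρ₀) : Ω ∩ ball c r = {z | 0 < ((z - c) * u).im} ∩ ball c r := by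
  ext z
  constructor
  · rintro ⟨hzΩ, hz⟩
    exact ⟨(mem_iff_of_flat h (ball_subset_ball hr hz)).1 hzΩ, hz⟩
  · rintro ⟨hh, hz⟩
    exact ⟨(mem_iff_of_flat h (ball_subset_ball hr hz)).2 hh, hz⟩

/-- The centre of a flat ball is not in the domain (its height is `0`). [folklore] -/
theorem center_not_mem_of_flat (h : Ω ∩ ball c ρ₀ = {z | 0 < ((z - c) * u).im} ∩ ball c ρ₀)
    (hρ₀ : 0 < ρ₀) : c ∉ Ω := by
  intro hc
  have := (mem_iff_of_flat h (mem_ball_self hρ₀)).1 hc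
  simp at this

/-- The form in which the route states flatness, `Ω ∩ B = {z | u = 0 ∨ 0 < Im((z-c)u)} ∩ B`,
is the plain form once `u ≠ 0`. [folklore] -/
theorem flat_of_route_form (hu : u ≠ 0)
    (h : Ω ∩ ball c ρ₀ = {z | u = 0 ∨ 0 < ((z - c) * u).im} ∩ ball c ρ₀) :
    Ω ∩ ball c ρ₀ = {z | 0 < ((z - c) * u).im} ∩ ball c ρ₀ := by
  rw [h]
  ext z
  simp [hu]

/-- Conversely the plain form gives the route form at every smaller radius. [folklore] -/
theorem route_form_of_flat (h : Ω ∩ ball c ρ₀ = {z | 0 < ((z - c) * u).im} ∩ ball c ρ₀)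
    (hu : u ≠ 0) {r : ℝ} (hr : r ≤ ρ₀) :
    Ω ∩ ball c r = {z | u = 0 ∨ 0 < ((z - c) * u).im} ∩ ball c r := by
  rw [flat_mono h hr]
  ext z
  simp [hu]

/-- In the route, `u = 0` is impossible at a point `c ∉ Ω` (a marked boundary point): the
route's flatness clause would put `c ∈ B(c, ρ₀) ⊆ Ω`. [folklore] -/
theorem ne_zero_of_route_form (hc : c ∉ Ω) (hρ₀ : 0 < ρ₀)
    (h : Ω ∩ ball c ρ₀ = {z | u = 0 ∨ 0 < ((z - c) * u).im} ∩ ball c ρ₀) : u ≠ 0 := by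
  intro hu
  have : c ∈ {z | u = 0 ∨ 0 < ((z - c) * u).im} ∩ ball c ρ₀ := ⟨Or.inl hu, mem_ball_self hρ₀⟩
  rw [← h] at this
  exact hc this.1

end Flat

/-! ## Lattice steps -/

/-- `Site.toComplex` is additive. [folklore] -/
theorem toComplex_add (x y : Site 2) :
    Site.toComplex (x + y) = Site.toComplex x + Site.toComplex y := by
  apply Complex.ext <;> simp

/-- Mesh points are additive: `δ (a + v) = δ a + δ · v`. [folklore] -/
theorem meshPoint_add (δ : ℝ) (a v : Site 2) :
    meshPoint δ (a + v) = meshPoint δ a + (δ : ℂ) * Site.toComplex v := by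
  simp only [meshPoint, toComplex_add, mul_add]

/-- The four lattice unit steps as complex numbers: `toComplex (single i s) = s · eᵢ` with
`e₀ = 1`, `e₁ = i`. [folklore] -/
theorem toComplex_single (i : Fin 2) (s : ℤ) :
    Site.toComplex (Pi.single i s) = (s : ℂ) * (if i = 0 then 1 else Complex.I) := by
  apply Complex.ext
  · fin_cases i <;> simp [Site.toComplex]
  · fin_cases i <;> simp [Site.toComplex]

/-- Unit steps have norm `1`. [folklore] -/
theorem norm_toComplex_single (i : Fin 2) {s : ℤ} (hs : s = 1 ∨ s = -1) :
    ‖Site.toComplex (Pi.single i s)‖ = 1 := by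
  rw [toComplex_single]
  rcases hs with rfl | rfl <;> fin_cases i <;> simp

/-- Scaling a unit step: `toComplex (single i (k s)) = k · toComplex (single i s)`. [folklore] -/
theorem toComplex_single_mul (i : Fin 2) (s k : ℤ) :
    Site.toComplex (Pi.single i (k * s)) = (k : ℂ) * Site.toComplex (Pi.single i s) := by
  rw [toComplex_single, toComplex_single]
  push_cast
  ring

/-- The mesh point `k` steps along a ray: `δ (a + single i (k s)) = δ a + (δ k) · e`. [folklore] -/
theorem meshPoint_ray (δ : ℝ) (a : Site 2) (i : Fin 2) (s : ℤ) (k : ℕ) :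
    meshPoint δ (a + Pi.single i ((k : ℤ) * s)) =
      meshPoint δ a + ((δ * k : ℝ) : ℂ) * Site.toComplex (Pi.single i s) := by
  rw [meshPoint_add, toComplex_single_mul]
  push_cast
  ring

/-- Consecutive points of a ray are lattice neighbours. [folklore] -/
theorem zdGraph_adj_ray_succ (a : Site 2) (i : Fin 2) {s : ℤ} (hs : s = 1 ∨ s = -1) (k : ℕ) :
    (zdGraph 2).Adj (a + Pi.single i ((k : ℤ) * s)) (a + Pi.single i (((k + 1 : ℕ) : ℤ) * s)) := by
  have : a + Pi.single i (((k + 1 : ℕ) : ℤ) * s) =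
      (a + Pi.single i ((k : ℤ) * s)) + Pi.single i s := by
    rw [add_assoc, ← Pi.single_add]
    congr 2
    push_cast
    ring
  rw [this]
  exact zdGraph_adj_add_single _ i hs

/-! ## Squared distance along a ray -/

/-- **Squared distance along a line**: `‖x + t e‖² = ‖x‖² + 2 t Re(x ē) + t²` for `‖e‖ = 1`.
[folklore] -/
theorem sq_norm_add_real_mul (x e : ℂ) (he : ‖e‖ = 1) (t : ℝ) :
    ‖x + (t : ℂ) * e‖ ^ 2 = ‖x‖ ^ 2 + 2 * t * (x * conj e).re + t ^ 2 := by
  have h1 : ‖x + (t : ℂ) * e‖ ^ 2 =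
      ‖x‖ ^ 2 + 2 * (inner ℝ x ((t : ℂ) * e)) + ‖(t : ℂ) * e‖ ^ 2 := norm_add_sq_real x _
  have h2 : inner ℝ x ((t : ℂ) * e) = t * (x * conj e).re := by
    rw [Complex.inner]
    simp only [Complex.mul_re, Complex.mul_im, Complex.conj_re, Complex.conj_im,
      Complex.ofReal_re, Complex.ofReal_im]
    ring
  rw [h1, h2, norm_mul, he, mul_one, Complex.norm_real, Real.norm_eq_abs, sq_abs]
  ring

/-- Along a direction making a non-obtuse angle with `x`, the squared norm grows at least
quadratically: `‖x‖² + t² ≤ ‖x + t e‖²` for `t ≥ 0`, `Re(x ē) ≥ 0`. [folklore] -/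
theorem sq_norm_add_real_mul_ge (x e : ℂ) (he : ‖e‖ = 1) {t : ℝ} (ht : 0 ≤ t)
    (hxe : 0 ≤ (x * conj e).re) : ‖x‖ ^ 2 + t ^ 2 ≤ ‖x + (t : ℂ) * e‖ ^ 2 := by
  rw [sq_norm_add_real_mul x e he t]
  nlinarith [mul_nonneg ht hxe]

/-! ## A good direction from a point of positive height -/

/-- **A good lattice direction.** If `0 < Im((w - c) u)` then some lattice unit step `e` has
`Im(e u) > 0` (the height increases along `e`) and `Re((w - c) ē) ≥ 0` (the distance to `c` does
not decrease along `e`). Indeed `Im((w-c)u) = Re(w-c) Im u + Im(w-c) Re u`, so one of the two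
products is positive, and the corresponding step `±1` or `±i` works. [folklore] -/
theorem exists_good_step {c u w : ℂ} (hw : 0 < ((w - c) * u).im) :
    ∃ (i : Fin 2) (s : ℤ), (s = 1 ∨ s = -1) ∧ 0 < (Site.toComplex (Pi.single i s) * u).im ∧
      0 ≤ ((w - c) * conj (Site.toComplex (Pi.single i s))).re := by
  have v0 : Site.toComplex (Pi.single (0 : Fin 2) (1 : ℤ)) = 1 := by rw [toComplex_single]; simp
  have v1 : Site.toComplex (Pi.single (0 : Fin 2) (-1 : ℤ)) = -1 := by rw [toComplex_single]; simp
  have v2 : Site.toComplex (Pi.single (1 : Fin 2) (1 : ℤ)) = Complex.I := by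
    rw [toComplex_single]; simp
  have v3 : Site.toComplex (Pi.single (1 : Fin 2) (-1 : ℤ)) = -Complex.I := by
    rw [toComplex_single]; simp
  have hh : ((w - c) * u).im = (w - c).re * u.im + (w - c).im * u.re := by
    simp [Complex.mul_im]
  rw [hh] at hw
  have r0 : ((w - c) * conj (1 : ℂ)).re = (w - c).re := by simp
  have r1 : ((w - c) * conj (-1 : ℂ)).re = -(w - c).re := by simp
  have r2 : ((w - c) * conj Complex.I).re = (w - c).im := by simp
  have r3 : ((w - c) * conj (-Complex.I)).re = -(w - c).im := by simp
  have i0 : ((1 : ℂ) * u).im = u.im := by simp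
  have i1 : ((-1 : ℂ) * u).im = -u.im := by simp
  have i2 : (Complex.I * u).im = u.re := by simp
  have i3 : (-Complex.I * u).im = -u.re := by simp
  by_cases hA : 0 < (w - c).re * u.im
  · rcases lt_or_ge 0 u.im with hui | hui
    · refine ⟨0, 1, Or.inl rfl, ?_, ?_⟩
      · rw [v0, i0]; exact hui
      · rw [v0, r0]
        by_contra hneg; push Not at hneg; nlinarith
    · have hui' : u.im < 0 :=
        lt_of_le_of_ne hui (fun h => by rw [h, mul_zero] at hA; exact lt_irrefl _ hA)
      refine ⟨0, -1, Or.inr rfl, ?_, ?_⟩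
      · rw [v1, i1]; linarith
      · rw [v1, r1]
        by_contra hneg; push Not at hneg; nlinarith
  · have hB : 0 < (w - c).im * u.re := by
      push Not at hA
      linarith
    rcases lt_or_ge 0 u.re with hur | hur
    · refine ⟨1, 1, Or.inl rfl, ?_, ?_⟩
      · rw [v2, i2]; exact hur
      · rw [v2, r2]
        by_contra hneg; push Not at hneg; nlinarith
    · have hur' : u.re < 0 :=
        lt_of_le_of_ne hur (fun h => by rw [h, mul_zero] at hB; exact lt_irrefl _ hB)
      refine ⟨1, -1, Or.inr rfl, ?_, ?_⟩
      · rw [v3, i3]; linarith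
      · rw [v3, r3]
        by_contra hneg; push Not at hneg; nlinarith

/-! ## The direction of steepest ascent and the escape estimate -/

/-- **The direction of steepest ascent.** For every `u` some lattice unit step `e₊` has ascent
rate `Im(e₊ u) = max(|Re u|, |Im u|)` and transverse rate `|Re(e₊ u)| ≤ max(|Re u|, |Im u|)`.
[folklore] -/
theorem exists_best_step (u : ℂ) :
    ∃ (i : Fin 2) (s : ℤ), (s = 1 ∨ s = -1) ∧
      (Site.toComplex (Pi.single i s) * u).im = max |u.re| |u.im| ∧
      |(Site.toComplex (Pi.single i s) * u).re| ≤ max |u.re| |u.im| := by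
  have v0 : Site.toComplex (Pi.single (0 : Fin 2) (1 : ℤ)) = 1 := by rw [toComplex_single]; simp
  have v1 : Site.toComplex (Pi.single (0 : Fin 2) (-1 : ℤ)) = -1 := by rw [toComplex_single]; simp
  have v2 : Site.toComplex (Pi.single (1 : Fin 2) (1 : ℤ)) = Complex.I := by
    rw [toComplex_single]; simp
  have v3 : Site.toComplex (Pi.single (1 : Fin 2) (-1 : ℤ)) = -Complex.I := by
    rw [toComplex_single]; simp
  by_cases h1 : |u.re| ≤ |u.im|
  · by_cases h2 : 0 ≤ u.im
    · refine ⟨0, 1, Or.inl rfl, ?_, ?_⟩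
      · rw [v0, one_mul, max_eq_right h1, abs_of_nonneg h2]
      · rw [v0, one_mul]; exact le_max_left _ _
    · push Not at h2
      refine ⟨0, -1, Or.inr rfl, ?_, ?_⟩
      · rw [v1, neg_one_mul, Complex.neg_im, max_eq_right h1, abs_of_neg h2]
      · rw [v1, neg_one_mul, Complex.neg_re, abs_neg]; exact le_max_left _ _
  · push Not at h1
    by_cases h3 : 0 ≤ u.re
    · refine ⟨1, 1, Or.inl rfl, ?_, ?_⟩
      · rw [v2, Complex.I_mul_im, max_eq_left h1.le, abs_of_nonneg h3]
      · rw [v2, Complex.I_mul_re, abs_neg]; exact le_max_right _ _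
    · push Not at h3
      refine ⟨1, -1, Or.inr rfl, ?_, ?_⟩
      · rw [v3, neg_mul, Complex.neg_im, Complex.I_mul_im, max_eq_left h1.le, abs_of_neg h3]
      · rw [v3, neg_mul, Complex.neg_re, Complex.I_mul_re, neg_neg]; exact le_max_right _ _

/-- The ascent rate dominates `‖u‖/√2`: `‖u‖² ≤ 2 (max(|Re u|, |Im u|))²`. [folklore] -/
theorem sq_norm_le_two_mul_sq_rate (u : ℂ) : ‖u‖ ^ 2 ≤ 2 * (max |u.re| |u.im|) ^ 2 := by
  rw [Complex.sq_norm, Complex.normSq_apply]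
  have h1 : |u.re| ≤ max |u.re| |u.im| := le_max_left _ _
  have h2 : |u.im| ≤ max |u.re| |u.im| := le_max_right _ _
  have h3 : u.re * u.re = |u.re| ^ 2 := by rw [sq_abs]; ring
  have h4 : u.im * u.im = |u.im| ^ 2 := by rw [sq_abs]; ring
  rw [h3, h4]
  nlinarith [abs_nonneg u.re, abs_nonneg u.im]

/-- The ascent rate is positive for `u ≠ 0`. [folklore] -/
theorem rate_pos {u : ℂ} (hu : u ≠ 0) : 0 < max |u.re| |u.im| := by
  by_contra h
  push Not at h
  have h1 : |u.re| ≤ 0 := (le_max_left _ _).trans h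
  have h2 : |u.im| ≤ 0 := (le_max_right _ _).trans h
  apply hu
  apply Complex.ext
  · simpa using abs_nonpos_iff.1 h1
  · simpa using abs_nonpos_iff.1 h2

/-- Decomposition of a complex number along a unit vector: `x = (x ē) e`. [folklore] -/
theorem eq_mul_conj_mul (x e : ℂ) (he : ‖e‖ = 1) : x = (x * conj e) * e := by
  have : conj e * e = 1 := by
    rw [mul_comm, Complex.mul_conj, Complex.normSq_eq_norm_sq, he]
    simp
  rw [mul_assoc, this, mul_one]

/-- **The escape estimate.** Let `e` be a unit vector with `Im(e u) = u⋆ ≥ |Re(e u)|`, `u⋆ > 0`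
(the direction of steepest ascent). If `0 < Im((p - c) u)` then along the ray `p + t e`
(`t ≥ 0`) the squared distance to `c` stays at least half its initial value: with
`A = Re((p-c) ē)`, `B = Im((p-c) ē)` one has `0 < A u⋆ + B Re(e u) ≤ A u⋆ + |B| u⋆`, so `A < 0`
forces `B² > A²`, whence `(A+t)² + B² ≥ B² > (A² + B²)/2`. [folklore] -/
theorem sq_norm_add_ge_half {c u p e : ℂ} (he : ‖e‖ = 1) {us : ℝ} (hus : 0 < us)
    (hrate : (e * u).im = us) (htrans : |(e * u).re| ≤ us) (hp : 0 < ((p - c) * u).im)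
    {t : ℝ} (ht : 0 ≤ t) : ‖p - c‖ ^ 2 / 2 ≤ ‖p + (t : ℂ) * e - c‖ ^ 2 := by
  set x := p - c with hx
  set A := (x * conj e).re with hA
  set B := (x * conj e).im with hB
  have hxe : x = (x * conj e) * e := eq_mul_conj_mul x e he
  -- `‖x‖² = A² + B²`
  have hnorm : ‖x‖ ^ 2 = A ^ 2 + B ^ 2 := by
    have : ‖x‖ = ‖x * conj e‖ := by
      rw [norm_mul, Complex.norm_conj, he, mul_one]
    rw [this, Complex.sq_norm, Complex.normSq_apply, hA, hB]
    ring
  -- the height in terms of `A`, `B`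
  have hh : ((p - c) * u).im = A * (e * u).im + B * (e * u).re := by
    rw [show p - c = x from rfl]
    conv_lhs => rw [hxe]
    rw [show x * conj e * e * u = (x * conj e) * (e * u) by ring, Complex.mul_im, hA, hB]
  rw [hrate] at hh
  -- the ray
  have hray : ‖p + (t : ℂ) * e - c‖ ^ 2 = ‖x‖ ^ 2 + 2 * t * A + t ^ 2 := by
    rw [show p + (t : ℂ) * e - c = x + (t : ℂ) * e by rw [hx]; ring]
    exact sq_norm_add_real_mul x e he t
  rw [hray, hnorm]
  by_cases hA0 : 0 ≤ A
  · nlinarith [sq_nonneg A, sq_nonneg B, mul_nonneg ht hA0, sq_nonneg t]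
  · push Not at hA0
    have h1 : B * (e * u).re ≤ |B| * us := by
      calc B * (e * u).re ≤ |B * (e * u).re| := le_abs_self _
        _ = |B| * |(e * u).re| := abs_mul _ _
        _ ≤ |B| * us := by gcongr
    have h2 : 0 < A * us + |B| * us := by linarith
    have h3 : -A < |B| := by
      by_contra h4
      push Not at h4
      have : A * us + |B| * us ≤ 0 := by nlinarith
      linarith
    have h4 : A ^ 2 < B ^ 2 := by
      have : |A| < |B| := by rw [abs_of_neg hA0]; exact h3
      exact sq_lt_sq.2 (by simpa using this)
    nlinarith [sq_nonneg (A + t), sq_nonneg B]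

/-! ## Points of a segment of a ray -/

/-- Points of the segment `[p + a e, p + b e]` (real multiples, `a ≤ b`) are of the form
`p + t e` with `t ∈ [a, b]`. [folklore] -/
theorem exists_of_mem_segment_ray {p e z : ℂ} {a b : ℝ} (hab : a ≤ b)
    (hz : z ∈ segment ℝ (p + (a : ℂ) * e) (p + (b : ℂ) * e)) :
    ∃ t : ℝ, a ≤ t ∧ t ≤ b ∧ z = p + (t : ℂ) * e := by
  rw [segment_eq_image] at hz
  obtain ⟨θ, ⟨hθ0, hθ1⟩, rfl⟩ := hz
  refine ⟨(1 - θ) * a + θ * b, by nlinarith, by nlinarith, ?_⟩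
  simp only [Complex.real_smul]
  push_cast
  ring

end Summit.CriticalPhenomena.SAWScalingLimit.Theorems.ScreeningRecursion

end
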